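import Mathlib.Algebra.Order.Ring.Abs
import Mathlib.Algebra.Order.Group.Unbundled.Abs
import Mathlib.Data.Real.Basic
import Mathlib.Algebra.Group.Even
import Mathlib.Tactic
import HarnessLib

/-!
# Route `AposterioriCapRg` — crux `SsbToEvenTorusLro` (stmt-HubbardSuperconductivity-1315),
# line `floating-mu-two-sided-pair-transfer`, stub `stub_ladderInductionChains` (INDUCTION helper 2/2a)

The two finite CHAINS of the sector-hopping ladder, over an ABSTRACT floor predicate
`G : ℕ → ℝ → Prop` ("every normalised ground state of the sector `m` has pair order `≥ F`"),
antitone in the floor `F`. From a start `G m₀ F₀` (`m₀`, `N` even, `|m₀ − N| ≤ W`), one-rung steps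
towards `N` costing `ℓ ≥ 0` each (DOWN: `G (n+2) F → G n (F − ℓ)` for `N ≤ n`, `n + 2 ≤ m₀`; UP:
`G (n+2) F → G (n+4) (F − ℓ)` for `m₀ ≤ n + 2`, `n + 4 ≤ N`; both only while `F_min ≤ F`), and the
budget `F_min ≤ F₀ − J'ℓ` for all real `0 ≤ J'` with `2J' ≤ W`, conclude `G N F_min`: induction on the
number of rungs `|m₀ − N| / 2 ≤ W / 2`, then antitonicity. Pure `ℕ`/`ℝ` bookkeeping, no matrices; it is
instantiated at fixed side `L` in the companion file (stub `stub_ladderInduction`).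
Source: T. Koma, H. Tasaki, J. Stat. Phys. 76 (1994) 745, §2 (tower of states); the chain itself is folklore.
-/

namespace Summit.HubbardSuperconductivity.HubbardSuperconductivity.Theorems

-- summit = problem name (single-conjunct summit), D-0017
set_option linter.dupNamespace false

/-- **The two chains of the ladder (abstract floor predicate).** See the module docstring:
`G m₀ F₀`, antitone `G`, DOWN/UP one-rung steps of cost `ℓ ≥ 0` towards `N` valid while `F_min ≤ F`,
and the budget `F_min ≤ F₀ − J'ℓ` (`0 ≤ 2J' ≤ W`, `|m₀ − N| ≤ W`) give `G N F_min`.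
Koma–Tasaki (1994) §2. [folklore] -/
theorem stub_ladderInductionChains :
    ∀ (G : ℕ → ℝ → Prop) (N m₀ : ℕ) (W F₀ ℓ Fmin : ℝ), Even N → Even m₀ → |(m₀ : ℝ) - (N : ℝ)| ≤ W → 2 ≤ m₀ → (∀ (m : ℕ) (F F' : ℝ), F' ≤ F → G m F → G m F') → G m₀ F₀ → (∀ (n : ℕ) (F : ℝ), Even n → N ≤ n → n + 2 ≤ m₀ → Fmin ≤ F → G (n + 2) F → G n (F - ℓ)) → (∀ (n : ℕ) (F : ℝ), Even n → m₀ ≤ n + 2 → n + 4 ≤ N → Fmin ≤ F → G (n + 2) F → G (n + 4) (F - ℓ)) → 0 ≤ ℓ → (∀ J' : ℝ, 0 ≤ J' → 2 * J' ≤ W → Fmin ≤ F₀ - J' * ℓ) → G N Fmin := by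
  intro G N m₀ W F₀ ℓ Fmin hN hm₀ hW h2 hanti hstart hdown hup _hℓ hbudget
  obtain ⟨a, ha⟩ := hN
  obtain ⟨b, hb⟩ := hm₀
  -- the budget, specialised to a natural number `j` of rungs with `2 j ≤ |m₀ - N|`
  have hbud :
      ∀ j : ℕ, 2 * j + m₀ ≤ N ∨ 2 * j + N ≤ m₀ → Fmin ≤ F₀ - (j : ℝ) * ℓ := by
    intro j hj
    apply hbudget _ (Nat.cast_nonneg j)
    rcases hj with hj | hj
    · have h1 := (Nat.cast_le (α := ℝ)).mpr hj
      push_cast at h1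
      have h2 : (N : ℝ) - (m₀ : ℝ) ≤ |(m₀ : ℝ) - (N : ℝ)| := by
        rw [abs_sub_comm]
        exact le_abs_self _
      linarith
    · have h1 := (Nat.cast_le (α := ℝ)).mpr hj
      push_cast at h1
      have h2 : (m₀ : ℝ) - (N : ℝ) ≤ |(m₀ : ℝ) - (N : ℝ)| := le_abs_self _
      linarith
  rcases le_or_gt m₀ N with hle | hlt
  · -- UP chain: `N = m₀ + 2 (a - b)`; after `j` rungs we sit at `m₀ + 2 j`,
    -- floor `F₀ - j ℓ`.
    have key : ∀ j : ℕ, j ≤ a - b → G (m₀ + 2 * j) (F₀ - (j : ℝ) * ℓ) := by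
      intro j
      induction j with
      | zero =>
        intro _
        simpa using hstart
      | succ j ih =>
        intro hj
        have hG := ih (by omega)
        have hn : m₀ + 2 * j - 2 + 2 = m₀ + 2 * j := by omega
        have heven : Even (m₀ + 2 * j - 2) := ⟨b + j - 1, by omega⟩
        have hF : Fmin ≤ F₀ - (j : ℝ) * ℓ := hbud j (Or.inl (by omega))
        have hstep := hup (m₀ + 2 * j - 2) (F₀ - (j : ℝ) * ℓ) heven (by omega) (by omega) hF
          (by rw [hn]; exact hG)
        have e1 : m₀ + 2 * j - 2 + 4 = m₀ + 2 * (j + 1) := by omega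
        have e2 : F₀ - (j : ℝ) * ℓ - ℓ = F₀ - ((j + 1 : ℕ) : ℝ) * ℓ := by
          push_cast
          ring
        rw [e1, e2] at hstep
        exact hstep
    have hfin := key (a - b) le_rfl
    have e : m₀ + 2 * (a - b) = N := by omega
    rw [e] at hfin
    exact hanti N _ _ (hbud (a - b) (Or.inl (by omega))) hfin
  · -- DOWN chain: `m₀ = N + 2 (b - a)`; after `j` rungs we sit at `N + 2 (b - a - j)`,
    -- floor `F₀ - j ℓ`.
    have key : ∀ j : ℕ, j ≤ b - a → G (N + 2 * (b - a - j)) (F₀ - (j : ℝ) * ℓ) := by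
      intro j
      induction j with
      | zero =>
        intro _
        have e : N + 2 * (b - a - 0) = m₀ := by omega
        rw [e]
        simpa using hstart
      | succ j ih =>
        intro hj
        have hG := ih (by omega)
        have hn : N + 2 * (b - a - (j + 1)) + 2 = N + 2 * (b - a - j) := by omega
        have heven : Even (N + 2 * (b - a - (j + 1))) := ⟨a + (b - a - (j + 1)), by omega⟩
        have hF : Fmin ≤ F₀ - (j : ℝ) * ℓ := hbud j (Or.inr (by omega))
        have hstep := hdown (N + 2 * (b - a - (j + 1))) (F₀ - (j : ℝ) * ℓ) heven (by omega)
          (by omega) hF (by rw [hn]; exact hG)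
        have e2 : F₀ - (j : ℝ) * ℓ - ℓ = F₀ - ((j + 1 : ℕ) : ℝ) * ℓ := by
          push_cast
          ring
        rw [e2] at hstep
        exact hstep
    have hfin := key (b - a) le_rfl
    have e : N + 2 * (b - a - (b - a)) = N := by omega
    rw [e] at hfin
    exact hanti N _ _ (hbud (b - a) (Or.inr (by omega))) hfin

end Summit.HubbardSuperconductivity.HubbardSuperconductivity.Theorems
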